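import Mathlib
import HarnessLib
import Summits.NavierStokesRegularity.NavierStokesRegularity.Theorems.PoloidalWindowDoorLrcModEntireGraphSheetUniqueness
import Summits.NavierStokesRegularity.NavierStokesRegularity.Theorems.PoloidalWindowDoorLrcModEntireQ4CurvedPeriodic
import Summits.NavierStokesRegularity.NavierStokesRegularity.Theorems.PoloidalWindowDoorLrcModEntireHorizontalPeriodAtTime
import Summits.NavierStokesRegularity.NavierStokesRegularity.Theorems.PoloidalWindowDoorLrcModEntireWebPackageAnalytic

/-!
# Route `PoloidalWindowDoor`, item `LrcModEntire` (stmt-NavierStokesRegularity-20428), cell (Q4-sonic, straight, μ < 0) `stub_Q4sonicLineNeg`, case II —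
# AN `s`-PERIODIC WEB SHEET AT A NON-SONIC TIME IS IMPOSSIBLE (the (Q4-curved-periodic) lever ported to time `−1+τ`, graph coordinates)

Cell ns-regularity-ideate, stub-worker seat ns-poloidal-K2-p2 g18 under the LEAD of item 20428 (ns-poloidal-K2-p3 g17/g18);
`--supports stmt-NavierStokesRegularity-20428 --as helper`.  LEAD word 2026-08-29T23:01:43Z (v15 architecture for the case-II slot `stub_Q4sonicLineNegIsolated`:
split the curved END `…CaseIIEntranceSharp.caseII_false_of_curvedEnd'` by «periodic curvature modulation of the base web at SOME non-sonic `τ`» — closable by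
porting this seat's g16 `…Q4CurvedPeriodic` to time `−1+τ` — versus «aperiodic at every non-sonic `τ`»).  This file is the class-level core of the periodic child.

★ `false_of_periodic_sheet_at_time` — in the currency of the curved END (hull element `U` of the route's class, poloidal, slab slope law with `μ(t,z)`, horizontal
unit `e`, the frame-form strict concavity + web Fermat law on the `δ`-box, the space–time web package `n₀, κt` on the `δ′`-box of port-2's
`…Q4TimeWebPackage.time_web_package_line`), at a time `τ` of the box (`|τ| < δ′`) which is NON-sonic (`R(τ,·)` not affine on `|z| < δ`), an `s`-PERIOD of the web
sheet on a height window, `n₀(τ, s+L, z) = n₀(τ, s, z)` (`L ≠ 0`, all `s`, `|z| < δ₃ ≤ δ′`) ⊢ `False`.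
PROOF.  (1) `z ↦ R(τ,z)` is real-analytic on `(−δ, δ)` (`…WebPackageAnalytic.ridgeHeight_analyticAt` over the web function of `…Q4TimeWebFunction` on the whole
`δ`-box), so non-sonic ⇒ `R_zz(τ,z₀) ≠ 0` at some `|z₀| < δ₃` (identity theorem for `R_zz(τ,·)`, `…Q4LineTools.affine_of_deriv_deriv_eq_zero`), and then on an open
height interval `I₀ ∋ z₀`.  (2) By the package's HUYGENS identity `κt·G_z² = (R_zz − μκt)(1 + G_s²)` for the web graph `G = n₀(τ,·,·)`, the sheet
`W(s,z) = s·e + G(s,z)·Je + z·e₂` is NON-characteristic over `I₀`: `G_z² + μ(1 + G_s²) = (R_zz/κt)(1 + G_s²) ≠ 0`.  (3) `w := U₂(−1+τ, · + L·e) − U₂(−1+τ, ·)` is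
real-analytic, solves the slice law `∂₂²w = −μ(−1+τ, x₂)Δₕw` on the slope slab (`plane_wave_identity`, translation), and has ZERO CAUCHY DATA on the sheet over
`|z| < δ₃` (values: the period maps the web at `(s,z)` to the web at `(s+L,z)`, both carry `σU₂ = R(τ,z)`; gradients: horizontal criticality of the package at both
points, vertical components equal by the web Fermat law through `…RidgeWebLaw.webData_of_fderiv_uncurry`).  (4) `…GraphSheetUniqueness.eqOn_zero_nhds_of_graphSheet`
(this seat, the graph-coordinate CK lever) ⇒ `w ≡ 0` near a sheet point ⇒ `…HorizontalPeriodAtTime.false_of_local_horizontalPeriod_shift` ⇒ `False`.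

WHAT THIS IS NOT: not a claim about Navier–Stokes regularity; the periodic half of the case-II residue at class level (the child closer in stub currency and
the aperiodic END are the next file); items 20428 / 19708 / 27893 OPEN (bears_on LADDER-NS N0).
-/

noncomputable section

set_option linter.dupNamespace false
set_option linter.style.longLine false

namespace Summit.NavierStokesRegularity.NavierStokesRegularity.Theorems.PoloidalWindowDoorLrcModEntirePeriodicSheetAtTime

open Set Function Filter Topology Metric
open scoped RealInnerProductSpace InnerProductSpace ContDiff
open Literature.Analysis Literature.Analysis.FluidPDE Literature.Analysis.UnboundedOperators
open Summit.NavierStokesRegularity.NavierStokesRegularity.Theorems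
open Summit.NavierStokesRegularity.NavierStokesRegularity.Theorems.LocalSineTubeDoorProfileAlignedWindowRigidityAncient
open Summit.NavierStokesRegularity.NavierStokesRegularity.Theorems.PoloidalWindowDoorPoloidalWindowRigidityWindow
open Summit.NavierStokesRegularity.NavierStokesRegularity.Theorems.PoloidalWindowDoorPoloidalWindowRigidityTimeHeightShearLinearSlice
open Summit.NavierStokesRegularity.NavierStokesRegularity.Theorems.PoloidalWindowDoorPoloidalWindowRigidityConstantShearSlice
open Summit.NavierStokesRegularity.NavierStokesRegularity.Theorems.PoloidalWindowDoorLrcModEntireSheetFlattenTools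
open Summit.NavierStokesRegularity.NavierStokesRegularity.Theorems.PoloidalWindowDoorLrcModEntireParallelWebsIdentity
open Summit.NavierStokesRegularity.NavierStokesRegularity.Theorems.PoloidalWindowDoorLrcModEntireRidgeGlobalBranchODE
open Summit.NavierStokesRegularity.NavierStokesRegularity.Theorems.PoloidalWindowDoorLrcModEntireRidgeGlobalBranchFrame
open Summit.NavierStokesRegularity.NavierStokesRegularity.Theorems.PoloidalWindowDoorLrcModEntireRidgeWebLaw
open Summit.NavierStokesRegularity.NavierStokesRegularity.Theorems.PoloidalWindowDoorLrcModEntireThreadPins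
open Summit.NavierStokesRegularity.NavierStokesRegularity.Theorems.PoloidalWindowDoorLrcModEntireQ4LineTools
open Summit.NavierStokesRegularity.NavierStokesRegularity.Theorems.PoloidalWindowDoorLrcModEntireQ4CurvedPeriodic
open Summit.NavierStokesRegularity.NavierStokesRegularity.Theorems.PoloidalWindowDoorLrcModEntireHorizontalPeriodAtTime
open Summit.NavierStokesRegularity.NavierStokesRegularity.Theorems.PoloidalWindowDoorLrcModEntireCurvedWebTools
open Summit.NavierStokesRegularity.NavierStokesRegularity.Theorems.PoloidalWindowDoorLrcModEntireRidgeClassConstants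
open Summit.NavierStokesRegularity.NavierStokesRegularity.Theorems.PoloidalWindowDoorLrcModEntireQ4TimeWebFunction
open Summit.NavierStokesRegularity.NavierStokesRegularity.Theorems.PoloidalWindowDoorLrcModEntireWebPackageAnalytic
open Summit.NavierStokesRegularity.NavierStokesRegularity.Theorems.PoloidalWindowDoorLrcModEntireGraphSheetUniqueness

variable {C : ℝ} {U : ℝ → EuclideanSpace ℝ (Fin 3) → EuclideanSpace ℝ (Fin 3)}

/-! ### 1. The ridge height is analytic in the height; non-sonic ⇒ a non-characteristic height in every sub-window -/

/-- **`z ↦ R(τ,z)` is real-analytic on `(−δ, δ)`** for every `|τ| < δ` — from the frame-form strict concavity and web law on the `δ`-box (the web function of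
`…Q4TimeWebFunction.exists_timeWebFunction` + `…WebPackageAnalytic.ridgeHeight_analyticAt`). -/
theorem ridgeHeight_analyticOnNhd_height (hUrate : HasTypeITimeDecay C U) (hUcont : ContinuousOn (uncurry U) (Iio (0 : ℝ) ×ˢ univ))
    (hUmild : ∀ s t : ℝ, s < t → t < 0 → ∀ x, U t x = heatExtension (U s) (t - s) x - oseenDuhamel 1 s U U t x)
    (hUdiv : ∀ t < 0, VectorCalculus.IsDivFree (U t))
    {σ : ℝ} {e : EuclideanSpace ℝ (Fin 3)} {r δ : ℝ} {R : ℝ → ℝ → ℝ} (hδh : δ ≤ 1 / 2)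
    (hconc : ∀ τ z : ℝ, |τ| < δ → |z| < δ → ∀ s : ℝ, ∀ n ∈ Ioo (-r) r,
      fderiv ℝ (fderiv ℝ (fun y => σ * U (-1 + τ) y 2)) (frameCLM e (s, n, z)) (Jvec e) (Jvec e) < 0)
    (hweb : ∀ τ z : ℝ, |τ| < δ → |z| < δ → ∀ s : ℝ, ∃ n₀ ∈ Ioo (-r) r, σ * U (-1 + τ) (frameCLM e (s, n₀, z)) 2 = R τ z ∧
      ∀ n ∈ Icc (-r) r, n ≠ n₀ → σ * U (-1 + τ) (frameCLM e (s, n, z)) 2 < R τ z)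
    {τ : ℝ} (hτ : |τ| < δ) : AnalyticOnNhd ℝ (R τ) (Ioo (-δ) δ) := by
  set T : Set ℝ := Ioo (-1 / 2 : ℝ) (1 / 2) with hT_def
  have hTo : IsOpen T := isOpen_Ioo
  obtain ⟨F, hF_def⟩ : ∃ F : ℝ → EuclideanSpace ℝ (Fin 3) → ℝ, F = fun τ y => σ * U (-1 + τ) y 2 := ⟨_, rfl⟩
  have hF : IsSmoothSpaceTimeOn T F := by
    have h := contDiffOn_uncurry_signed hUrate hUcont hUmild hUdiv σ (n := ⊤) (T := T) Subset.rfl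
    rw [hF_def]; exact h
  have hδT : Ioo (-δ) δ ⊆ T := fun τ hτ => ⟨by linarith [hτ.1], by linarith [hτ.2]⟩
  have hconcF : ∀ τ z : ℝ, |τ| < δ → |z| < δ → ∀ s : ℝ, ∀ n ∈ Ioo (-r) r,
      fderiv ℝ (fderiv ℝ (F τ)) (frameCLM e (s, n, z)) (Jvec e) (Jvec e) < 0 := by
    rw [hF_def]; exact hconc
  have hS : ∀ τ z : ℝ, |τ| < δ → |z| < δ → ∀ s : ℝ, ∃ n₀ ∈ Ioo (-r) r, F τ (frameCLM e (s, n₀, z)) = R τ z ∧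
      ∀ n ∈ Icc (-r) r, n ≠ n₀ → F τ (frameCLM e (s, n, z)) < R τ z := by
    rw [hF_def]; exact hweb
  obtain ⟨n₀, hspec, hcrit, -⟩ := exists_timeWebFunction (e := e) hTo hF hδT hconcF hS
  rw [hF_def] at hspec hcrit
  intro z hz
  have hz' : |z| < δ := abs_lt.2 ⟨hz.1, hz.2⟩
  have h := ridgeHeight_analyticAt hUrate hUcont hUmild hUdiv hδh hconc (fun q h1 h2 => (hspec q h1 h2).1) hcrit
    (R := R) (fun q h1 h2 => (hspec q h1 h2).2.1) hτ hz'
  have hline : AnalyticAt ℝ (fun z' : ℝ => ((τ, z') : ℝ × ℝ)) z := analyticAt_const.prod analyticAt_id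
  exact h.comp_of_eq hline rfl

/-- **Non-sonic ⇒ a non-characteristic height in every sub-window** (class-free): if `R(τ,·)` is real-analytic on `(−δ, δ)` and not affine on `|z| < δ`, then for
every `0 < δ₃ ≤ δ` there is an OPEN height set `I₀ ⊆ (−δ₃, δ₃)`, nonempty, on which `R_zz(τ,·) ≠ 0`. -/
theorem exists_noncharacteristic_window {g : ℝ → ℝ} {δ δ₃ : ℝ} (hδ₃ : 0 < δ₃) (hδ₃δ : δ₃ ≤ δ)
    (hg : AnalyticOnNhd ℝ g (Ioo (-δ) δ)) (hns : ¬ (∃ a b : ℝ, ∀ z : ℝ, |z| < δ → g z = a + b * z)) :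
    ∃ I₀ : Set ℝ, IsOpen I₀ ∧ I₀.Nonempty ∧ I₀ ⊆ Ioo (-δ₃) δ₃ ∧ ∀ z ∈ I₀, deriv (deriv g) z ≠ 0 := by
  have hδ : 0 < δ := lt_of_lt_of_le hδ₃ hδ₃δ
  set S : Set ℝ := Ioo (-δ) δ with hS
  have h0S : (0 : ℝ) ∈ S := ⟨by linarith, hδ⟩
  have hD1 : AnalyticOnNhd ℝ (deriv g) S := hg.deriv
  have hD2 : AnalyticOnNhd ℝ (deriv (deriv g)) S := hD1.deriv
  -- some height in the sub-window is non-characteristic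
  have hex : ∃ z₀ ∈ Ioo (-δ₃) δ₃, deriv (deriv g) z₀ ≠ 0 := by
    by_contra hall
    push Not at hall
    have hev : deriv (deriv g) =ᶠ[𝓝 (0 : ℝ)] 0 :=
      Filter.eventuallyEq_of_mem (isOpen_Ioo.mem_nhds (show (0 : ℝ) ∈ Ioo (-δ₃) δ₃ from ⟨by linarith, hδ₃⟩)) fun z hz => hall z hz
    have hzero := hD2.eqOn_zero_of_preconnected_of_eventuallyEq_zero isPreconnected_Ioo h0S hev
    have hgd : ∀ z ∈ S, DifferentiableAt ℝ g z := fun z hz => (hg z hz).differentiableAt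
    have hg'd : ∀ z ∈ S, DifferentiableAt ℝ (deriv g) z := fun z hz => (hD1 z hz).differentiableAt
    have haff := affine_of_deriv_deriv_eq_zero isOpen_Ioo isPreconnected_Ioo hgd hg'd (fun z hz => hzero hz) h0S
    exact hns ⟨g 0, deriv g 0, fun z hz => by rw [haff z (abs_lt.1 hz |> fun h => ⟨h.1, h.2⟩)]; ring⟩
  obtain ⟨z₀, hz₀, hne⟩ := hex
  have hsub : Ioo (-δ₃) δ₃ ⊆ S := fun z hz => ⟨by linarith [hz.1], by linarith [hz.2]⟩
  have hcont : ContinuousOn (deriv (deriv g)) (Ioo (-δ₃) δ₃) := (hD2.continuousOn).mono hsub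
  refine ⟨Ioo (-δ₃) δ₃ ∩ (deriv (deriv g)) ⁻¹' ({0}ᶜ), hcont.isOpen_inter_preimage isOpen_Ioo isOpen_compl_singleton,
    ⟨z₀, hz₀, hne⟩, inter_subset_left, fun z hz => hz.2⟩

/-! ### 2. The periodic web sheet at a non-sonic time -/

/-- ★ **AN `s`-PERIODIC WEB SHEET AT A NON-SONIC TIME OF THE BOX IS IMPOSSIBLE.**  See the module docstring; hypothesis names follow the curved END
`…CaseIIEntranceSharp.caseII_false_of_curvedEnd'`. -/
theorem false_of_periodic_sheet_at_time
    (hUrate : HasTypeITimeDecay C U) (hUcont : ContinuousOn (uncurry U) (Iio (0 : ℝ) ×ˢ univ))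
    (hUmild : ∀ s t : ℝ, s < t → t < 0 → ∀ x, U t x = heatExtension (U s) (t - s) x - oseenDuhamel 1 s U U t x)
    (hUdiv : ∀ t < 0, VectorCalculus.IsDivFree (U t))
    (hUpol : ∀ s < 0, ∀ q, ⟪curl (U s) q, EuclideanSpace.single 2 1⟫_ℝ = 0) (hUne : U (-1) 0 2 ≠ 0)
    {σ : ℝ} (hσ : σ = 1 ∨ σ = -1)
    {ρ : ℝ} (hρ : 0 < ρ) {μ : ℝ → ℝ → ℝ}
    (hslabU : ∀ t : ℝ, |t + 1| < ρ → ∀ x : EuclideanSpace ℝ (Fin 3), |x 2| < ρ → ∀ b : Fin 3, b ≠ 2 →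
      fderiv ℝ (U t) x (EuclideanSpace.single 2 1) b = μ t (x 2) * fderiv ℝ (U t) x (EuclideanSpace.single b 1) 2)
    {e : EuclideanSpace ℝ (Fin 3)} (he2 : e 2 = 0) (hunit : e 0 ^ 2 + e 1 ^ 2 = 1)
    {r δ : ℝ} {R : ℝ → ℝ → ℝ} (hδ : 0 < δ) (hδ4 : δ ≤ 1 / 4)
    (hconcF : ∀ τ z : ℝ, |τ| < δ → |z| < δ → ∀ s : ℝ, ∀ n ∈ Ioo (-r) r,
      fderiv ℝ (fderiv ℝ (fun y => σ * U (-1 + τ) y 2)) (frameCLM e (s, n, z)) (Jvec e) (Jvec e) < 0)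
    (hwebF : ∀ τ₀ z₀ : ℝ, |τ₀| < δ → |z₀| < δ → ∀ s₀ : ℝ, ∃ n₀ ∈ Ioo (-r) r,
      σ * U (-1 + τ₀) (frameCLM e (s₀, n₀, z₀)) 2 = R τ₀ z₀ ∧
      (∀ n ∈ Icc (-r) r, n ≠ n₀ → σ * U (-1 + τ₀) (frameCLM e (s₀, n, z₀)) 2 < R τ₀ z₀) ∧
      DifferentiableAt ℝ (uncurry R) (τ₀, z₀) ∧
      fderiv ℝ (uncurry fun τ y => σ * U (-1 + τ) y 2) (τ₀, frameCLM e (s₀, n₀, z₀)) =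
        (fderiv ℝ (uncurry R) (τ₀, z₀)).comp
          ((ContinuousLinearMap.fst ℝ ℝ (EuclideanSpace ℝ (Fin 3))).prod
            ((EuclideanSpace.proj (2 : Fin 3)).comp (ContinuousLinearMap.snd ℝ ℝ (EuclideanSpace ℝ (Fin 3))))))
    {δ' : ℝ} {n₀ : ℝ × ℝ × ℝ → ℝ} {κt : ℝ → ℝ → ℝ} (hδ'δ : δ' ≤ δ) (hδ'ρ : δ' ≤ ρ) (hδ'h : δ' < 1 / 2)
    (hpack : ∀ q : ℝ × ℝ × ℝ, |q.1| < δ' → |q.2.2| < δ' →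
      n₀ q ∈ Ioo (-r) r ∧
      σ * U (-1 + q.1) (frameCLM e (q.2.1, n₀ q, q.2.2)) 2 = R q.1 q.2.2 ∧
      (∀ n ∈ Icc (-r) r, n ≠ n₀ q → σ * U (-1 + q.1) (frameCLM e (q.2.1, n, q.2.2)) 2 < R q.1 q.2.2) ∧
      (∀ w : EuclideanSpace ℝ (Fin 3), w 2 = 0 → fderiv ℝ (fun y => U (-1 + q.1) y 2) (frameCLM e (q.2.1, n₀ q, q.2.2)) w = 0) ∧
      (∀ m : ℕ∞, ContDiffAt ℝ m n₀ q) ∧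
      0 < κt q.1 q.2.2 ∧
      fderiv ℝ (fderiv ℝ (fun y => σ * U (-1 + q.1) y 2)) (frameCLM e (q.2.1, n₀ q, q.2.2)) e e +
          fderiv ℝ (fderiv ℝ (fun y => σ * U (-1 + q.1) y 2)) (frameCLM e (q.2.1, n₀ q, q.2.2)) (Jvec e) (Jvec e) =
        -κt q.1 q.2.2 ∧
      κt q.1 q.2.2 * (fderiv ℝ n₀ q ((0 : ℝ), (0 : ℝ), (1 : ℝ))) ^ 2 =
        (deriv (deriv (R q.1)) q.2.2 - μ (-1 + q.1) q.2.2 * κt q.1 q.2.2) * (1 + (fderiv ℝ n₀ q ((0 : ℝ), (1 : ℝ), (0 : ℝ))) ^ 2))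
    {τ : ℝ} (hτ : |τ| < δ')
    (hns : ¬ (∃ a b : ℝ, ∀ z : ℝ, |z| < δ → R τ z = a + b * z))
    (hper : ∃ L δ₃ : ℝ, L ≠ 0 ∧ 0 < δ₃ ∧ δ₃ ≤ δ' ∧ ∀ s z : ℝ, |z| < δ₃ → n₀ (τ, s + L, z) = n₀ (τ, s, z)) : False := by
  obtain ⟨L, δ₃, hL, hδ₃, hδ₃δ', hperiod⟩ := hper
  have hσ0 : σ ≠ 0 := by rcases hσ with h | h <;> simp [h]
  have hδh : δ ≤ 1 / 2 := by linarith
  have hτδ : |τ| < δ := lt_of_lt_of_le hτ hδ'δ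
  have hτρ : |τ| < ρ := lt_of_lt_of_le hτ hδ'ρ
  have hτh : |τ| < 1 / 2 := lt_trans hτ hδ'h
  have ht₀ : (-1 : ℝ) + τ < 0 := by linarith [(abs_lt.1 hτh).2]
  have ht₀1 : |(-1 + τ) + 1| < ρ := by simpa using hτρ
  -- the horizontal unit `e`
  have hun : ‖e‖ = 1 := by
    have h := norm_sq_eq_sum3 e
    rw [he2] at h
    have h1 : ‖e‖ ^ 2 = 1 := by rw [h]; linear_combination hunit
    nlinarith [norm_nonneg e]
  -- the period vector
  set Lv : EuclideanSpace ℝ (Fin 3) := L • e with hLv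
  have hLv2 : Lv 2 = 0 := by simp [hLv, he2]
  have hLv0 : Lv ≠ 0 := by
    intro h
    have he0 : e ≠ 0 := by intro h'; rw [h', norm_zero] at hun; exact zero_ne_one hun
    rcases smul_eq_zero.1 (show L • e = 0 from h) with h' | h'
    · exact hL h'
    · exact he0 h'
  /- STEP 1: analyticity of the slice at time `−1+τ`. -/
  have hUan : AnalyticOnNhd ℝ (U (-1 + τ)) univ := analyticOnNhd_slice hUcont (bdd_of_hasTypeITimeDecay hUrate) hUmild ht₀
  have hU2 : ContDiff ℝ 2 (U (-1 + τ)) := hUan.contDiff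
  have hUd : Differentiable ℝ (U (-1 + τ)) := hU2.differentiable (by norm_num)
  have hθan : AnalyticOnNhd ℝ (fun y => U (-1 + τ) y 2) univ := fun x _ =>
    ((EuclideanSpace.proj (𝕜 := ℝ) (2 : Fin 3)).analyticAt _).comp (hUan x (mem_univ _))
  have hθ2 : ContDiff ℝ 2 (fun y => U (-1 + τ) y 2) := hθan.contDiff
  /- STEP 2: `w = θ(· + L•e) − θ`, analytic; the slice law on the slope slab at time `−1+τ`. -/
  set w : EuclideanSpace ℝ (Fin 3) → ℝ := fun y => U (-1 + τ) (y + Lv) 2 - U (-1 + τ) y 2 with hw_def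
  have hwan : AnalyticOnNhd ℝ w univ := by
    intro x _
    have hsh : AnalyticAt ℝ (fun y : EuclideanSpace ℝ (Fin 3) => y + Lv) x := analyticAt_id.add analyticAt_const
    exact ((hθan (x + Lv) (mem_univ _)).comp_of_eq hsh rfl).sub (hθan x (mem_univ _))
  have hplane : ∀ z : ℝ, |z| < ρ → ∀ y : EuclideanSpace ℝ (Fin 3), y 2 = z → ∀ b : Fin 3, b ≠ 2 →
      fderiv ℝ (U (-1 + τ)) y (EuclideanSpace.single 2 (1 : ℝ)) b = μ (-1 + τ) z * fderiv ℝ (U (-1 + τ)) y (EuclideanSpace.single b (1 : ℝ)) 2 := by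
    intro z hz y hy b hb
    have h := hslabU (-1 + τ) ht₀1 y (by rw [hy]; exact hz) b hb
    rw [hy] at h; exact h
  have hlawθ : ∀ x : EuclideanSpace ℝ (Fin 3), |x 2| < ρ →
      fderiv ℝ (fun y => fderiv ℝ (fun y' => U (-1 + τ) y' 2) y (EuclideanSpace.single 2 (1 : ℝ))) x (EuclideanSpace.single 2 (1 : ℝ)) =
        -μ (-1 + τ) (x 2) * (fderiv ℝ (fun y => fderiv ℝ (fun y' => U (-1 + τ) y' 2) y (EuclideanSpace.single 0 (1 : ℝ))) x
            (EuclideanSpace.single 0 (1 : ℝ)) +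
          fderiv ℝ (fun y => fderiv ℝ (fun y' => U (-1 + τ) y' 2) y (EuclideanSpace.single 1 (1 : ℝ))) x
            (EuclideanSpace.single 1 (1 : ℝ))) := fun x hx =>
    plane_wave_identity hU2 (fun y => div_coord (hUdiv (-1 + τ) ht₀) y) (hplane (x 2) hx) rfl
  have hlaww : ∀ x : EuclideanSpace ℝ (Fin 3), |x 2| < ρ →
      fderiv ℝ (fun y => fderiv ℝ w y (EuclideanSpace.single 2 (1 : ℝ))) x (EuclideanSpace.single 2 (1 : ℝ)) =
        -μ (-1 + τ) (x 2) * (fderiv ℝ (fun y => fderiv ℝ w y (EuclideanSpace.single 0 (1 : ℝ))) x (EuclideanSpace.single 0 (1 : ℝ)) +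
          fderiv ℝ (fun y => fderiv ℝ w y (EuclideanSpace.single 1 (1 : ℝ))) x (EuclideanSpace.single 1 (1 : ℝ))) := by
    intro x hxρ
    have hxL : (x + Lv) 2 = x 2 := by simp [hLv2]
    have h1 := hlawθ x hxρ
    have h2 := hlawθ (x + Lv) (by rw [hxL]; exact hxρ)
    rw [hxL] at h2
    rw [hw_def, nested_translate_sub hθ2, nested_translate_sub hθ2, nested_translate_sub hθ2, h1, h2]
    ring
  /- STEP 3: the web graph `G = n₀(τ,·,·)` at time `τ`; the package at the points `(τ,s,z)`. -/
  set G : ℝ × ℝ → ℝ := fun p => n₀ (τ, p) with hG_def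
  have hW : ∀ p : ℝ × ℝ, frameCLM e (p.1, n₀ (τ, p), p.2) = webMap e G p := fun p => by
    rw [frameCLM_apply]; rfl
  have hpk : ∀ p : ℝ × ℝ, |p.2| < δ' →
      n₀ (τ, p) ∈ Ioo (-r) r ∧
      σ * U (-1 + τ) (webMap e G p) 2 = R τ p.2 ∧
      (∀ n ∈ Icc (-r) r, n ≠ n₀ (τ, p) → σ * U (-1 + τ) (frameCLM e (p.1, n, p.2)) 2 < R τ p.2) ∧
      (∀ w : EuclideanSpace ℝ (Fin 3), w 2 = 0 → fderiv ℝ (fun y => U (-1 + τ) y 2) (webMap e G p) w = 0) ∧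
      (∀ m : ℕ∞, ContDiffAt ℝ m n₀ (τ, p)) ∧ 0 < κt τ p.2 ∧
      κt τ p.2 * (fderiv ℝ n₀ (τ, p) ((0 : ℝ), (0 : ℝ), (1 : ℝ))) ^ 2 =
        (deriv (deriv (R τ)) p.2 - μ (-1 + τ) p.2 * κt τ p.2) * (1 + (fderiv ℝ n₀ (τ, p) ((0 : ℝ), (1 : ℝ), (0 : ℝ))) ^ 2) := by
    intro p hp
    obtain ⟨h1, h2, h3, h4, h5, h6, -, h8⟩ := hpack (τ, p) hτ hp
    rw [hW p] at h2 h4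
    exact ⟨h1, h2, h3, h4, h5, h6, h8⟩
  -- differentiability of `G` and its partial derivatives
  have hGd : ∀ p : ℝ × ℝ, |p.2| < δ' → HasFDerivAt G ((fderiv ℝ n₀ (τ, p)).comp (ContinuousLinearMap.inr ℝ ℝ (ℝ × ℝ))) p := by
    intro p hp
    have hd : DifferentiableAt ℝ n₀ (τ, p) := ((hpk p hp).2.2.2.2.1 1).differentiableAt (by simp)
    exact hd.hasFDerivAt.comp p (hasFDerivAt_prodMk_right τ p)
  have hGdiff : ∀ p : ℝ × ℝ, |p.2| < δ' → DifferentiableAt ℝ G p := fun p hp => (hGd p hp).differentiableAt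
  have hGs : ∀ p : ℝ × ℝ, |p.2| < δ' → fderiv ℝ G p (1, 0) = fderiv ℝ n₀ (τ, p) ((0 : ℝ), (1 : ℝ), (0 : ℝ)) := by
    intro p hp; rw [(hGd p hp).fderiv]; simp
  have hGz : ∀ p : ℝ × ℝ, |p.2| < δ' → fderiv ℝ G p (0, 1) = fderiv ℝ n₀ (τ, p) ((0 : ℝ), (0 : ℝ), (1 : ℝ)) := by
    intro p hp; rw [(hGd p hp).fderiv]; simp
  /- STEP 4: the period maps the web at `(s,z)` onto the web at `(s+L,z)`. -/
  have hshift : ∀ p : ℝ × ℝ, |p.2| < δ₃ → webMap e G p + Lv = webMap e G (p.1 + L, p.2) := by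
    intro p hp
    have hper' : n₀ (τ, (p.1 + L, p.2)) = n₀ (τ, p) := hperiod p.1 p.2 hp
    simp only [webMap, hG_def, hper', hLv]
    module
  /- STEP 5: zero Cauchy data on the sheet over `|z| < δ₃`. -/
  have hδ₃δ : δ₃ ≤ δ := hδ₃δ'.trans hδ'δ
  have h0 : ∀ p : ℝ × ℝ, |p.2| < δ₃ → w (webMap e G p) = 0 := by
    intro p hp
    have hp' : |p.2| < δ' := lt_of_lt_of_le hp hδ₃δ'
    simp only [hw_def]
    rw [hshift p hp, sub_eq_zero]
    have hv1 := (hpk (p.1 + L, p.2) hp').2.1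
    have hv2 := (hpk p hp').2.1
    exact mul_left_cancel₀ hσ0 (hv1.trans hv2.symm)
  -- the web Fermat law at the package point `(s, z)`
  have hAweb : ∀ p : ℝ × ℝ, |p.2| < δ' →
      fderiv ℝ (uncurry fun τ' y => σ * U (-1 + τ') y 2) (τ, webMap e G p) =
        (fderiv ℝ (uncurry R) (τ, p.2)).comp ((ContinuousLinearMap.fst ℝ ℝ (EuclideanSpace ℝ (Fin 3))).prod
          ((EuclideanSpace.proj (2 : Fin 3)).comp (ContinuousLinearMap.snd ℝ ℝ (EuclideanSpace ℝ (Fin 3))))) := by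
    intro p hp
    obtain ⟨n₁, hn₁, hval₁, -, -, hfd⟩ := hwebF τ p.2 hτδ (lt_of_lt_of_le hp hδ'δ) p.1
    have hn : n₁ = n₀ (τ, p) := by
      by_contra hne
      exact absurd hval₁ ((hpk p hp).2.2.1 n₁ (Ioo_subset_Icc_self hn₁) hne).ne
    rw [hn, hW p] at hfd
    exact hfd
  have h1 : ∀ p : ℝ × ℝ, |p.2| < δ₃ → fderiv ℝ w (webMap e G p) = 0 := by
    intro p hp
    have hp' : |p.2| < δ' := lt_of_lt_of_le hp hδ₃δ'
    set P : EuclideanSpace ℝ (Fin 3) := webMap e G p with hP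
    have hθd : Differentiable ℝ (fun y => U (-1 + τ) y 2) := hθ2.differentiable (by norm_num)
    have hτd' : DifferentiableAt ℝ (fun y => U (-1 + τ) (y + Lv) 2) P := (hθd _).comp P (differentiableAt_id.add_const Lv)
    have hsh : fderiv ℝ (fun y => U (-1 + τ) (y + Lv) 2) P = fderiv ℝ (fun y => U (-1 + τ) y 2) (P + Lv) :=
      fderiv_comp_add_right (f := fun y => U (-1 + τ) y 2) Lv
    have hfw : fderiv ℝ w P = fderiv ℝ (fun y => U (-1 + τ) y 2) (P + Lv) - fderiv ℝ (fun y => U (-1 + τ) y 2) P := by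
      rw [hw_def, fderiv_fun_sub hτd' (hθd P), hsh]
    rw [hfw, sub_eq_zero, hP, hshift p hp]
    -- both gradients: horizontal parts vanish, vertical parts agree (web Fermat law, same `A = DR(τ,z)`)
    have hval : σ * U (-1 + τ) (webMap e G (p.1 + L, p.2)) 2 = σ * U (-1 + τ) (webMap e G p) 2 := by
      rw [(hpk (p.1 + L, p.2) hp').2.1, (hpk p hp').2.1]
    obtain ⟨-, -, hvert, -, -, -, -⟩ :=
      webData_of_fderiv_uncurry hUrate hUcont hUmild hUdiv hσ (τ₀ := τ) hτh (hAweb (p.1 + L, p.2) hp') (hAweb p hp') hval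
    refine clm_eq_of_apply_single fun i => ?_
    fin_cases i
    · rw [(hpk (p.1 + L, p.2) hp').2.2.2.1 _ (by simp), (hpk p hp').2.2.2.1 _ (by simp)]
    · rw [(hpk (p.1 + L, p.2) hp').2.2.2.1 _ (by simp), (hpk p hp').2.2.2.1 _ (by simp)]
    · simp only [Fin.reduceFinMk]
      rw [fderiv_apply_coord (U (-1 + τ)) (hUd _), fderiv_apply_coord (U (-1 + τ)) (hUd _)]
      exact hvert
  /- STEP 6: a non-characteristic height window `I₀ ⊆ (−δ₃, δ₃)` (non-sonic + analyticity of `R(τ,·)`), and the characteristic form via HUYGENS. -/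
  have hweb2 : ∀ τ' z : ℝ, |τ'| < δ → |z| < δ → ∀ s : ℝ, ∃ n₁ ∈ Ioo (-r) r, σ * U (-1 + τ') (frameCLM e (s, n₁, z)) 2 = R τ' z ∧
      ∀ n ∈ Icc (-r) r, n ≠ n₁ → σ * U (-1 + τ') (frameCLM e (s, n, z)) 2 < R τ' z := by
    intro τ' z hτ' hz s
    obtain ⟨n₁, hn₁, hv, hst, -, -⟩ := hwebF τ' z hτ' hz s
    exact ⟨n₁, hn₁, hv, hst⟩
  have hRan : AnalyticOnNhd ℝ (R τ) (Ioo (-δ) δ) := ridgeHeight_analyticOnNhd_height hUrate hUcont hUmild hUdiv hδh hconcF hweb2 hτδ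
  obtain ⟨I₀, hI₀o, hI₀ne, hI₀sub, hI₀Q⟩ := exists_noncharacteristic_window hδ₃ hδ₃δ hRan hns
  have hI₀δ₃ : ∀ z ∈ I₀, |z| < δ₃ := fun z hz => abs_lt.2 ⟨(hI₀sub hz).1, (hI₀sub hz).2⟩
  have hQ : ∀ p ∈ region I₀, (fderiv ℝ G p (0, 1)) ^ 2 + μ (-1 + τ) p.2 * (1 + (fderiv ℝ G p (1, 0)) ^ 2) ≠ 0 := by
    intro p hp hzero
    have hp3 : |p.2| < δ₃ := hI₀δ₃ p.2 hp
    have hp' : |p.2| < δ' := lt_of_lt_of_le hp3 hδ₃δ'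
    obtain ⟨-, -, -, -, -, hκ, hHuy⟩ := hpk p hp'
    rw [hGs p hp', hGz p hp'] at hzero
    set A := fderiv ℝ n₀ (τ, p) ((0 : ℝ), (1 : ℝ), (0 : ℝ))
    set B := fderiv ℝ n₀ (τ, p) ((0 : ℝ), (0 : ℝ), (1 : ℝ))
    have hR : deriv (deriv (R τ)) p.2 * (1 + A ^ 2) = 0 := by
      linear_combination -hHuy + κt τ p.2 * hzero
    have h1A : (1 + A ^ 2) ≠ 0 := by positivity
    exact hI₀Q p.2 hp ((mul_eq_zero.1 hR).resolve_right h1A)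
  /- STEP 7: Cauchy–Kovalevskaya across the graph sheet, then the periodic Liouville endgame at time `−1+τ`. -/
  obtain ⟨z₀, hz₀⟩ := hI₀ne
  have hρI : ∀ x : EuclideanSpace ℝ (Fin 3), x 2 ∈ I₀ → |x 2| < ρ := fun x hx =>
    lt_of_lt_of_le (hI₀δ₃ _ hx) (hδ₃δ'.trans hδ'ρ)
  have hev := eqOn_zero_nhds_of_graphSheet hwan hI₀o (fun p hp => hGdiff p (lt_of_lt_of_le (hI₀δ₃ p.2 hp) hδ₃δ')) he2 hun
    (μ := μ (-1 + τ)) (fun x hx => hlaww x (hρI x hx)) (fun p hp => h0 p (hI₀δ₃ p.2 hp)) (fun p hp => h1 p (hI₀δ₃ p.2 hp)) hQ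
    (p := ((0 : ℝ), z₀)) hz₀
  obtain ⟨V, hVsub, hVo, hPV⟩ := _root_.mem_nhds_iff.1 hev
  exact false_of_local_horizontalPeriod_shift hUrate hUcont hUmild hUdiv hUpol hUne hρ hslabU hτρ hτh hLv2 hLv0 hVo ⟨_, hPV⟩
    fun x hx => by have h := hVsub hx; simpa [hw_def, sub_eq_zero] using h

end Summit.NavierStokesRegularity.NavierStokesRegularity.Theorems.PoloidalWindowDoorLrcModEntirePeriodicSheetAtTime

end
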